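import Mathlib
import HarnessLib
import Summits.QuantumFields.YangMills.Theorems.HypercubicLimit.Negative.ExtendByZero
import Literature.MathematicalPhysics.QuantumFieldTheory.YangMillsOS
import Summits.QuantumFields.YangMills.Theorems.MirrorModularBoostsHypercubicLimitCauchyTransferAll
import Summits.QuantumFields.YangMills.Theorems.MirrorModularBoostsHypercubicLimitTypedResponseNoGo

/-!
# Line `Sketch` (holomorphic coupling response) of crux `HypercubicLimit` — the line's objects

Definitions file for crux `stmt-QuantumFields-16154` (`CoincidenceRotationBootstrap.HypercubicLimit` =
`MirrorModularBoosts.WeakCouplingHypercubicLimit`), line `Sketch` (card `holomorphic-coupling-response`,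
skeleton `Cruxes/HypercubicLimit/Lines/Sketch.lean`).  It carries the objects the line posits, so that its
remaining registered stubs (`stub_responseToMoments : … ResponseHolomorphy r sch s ε₁ C₀ C₁ → UniformMomentBounds r sch`,
`stub_closure : … → ∃ sch' S₁, … ∧ OneFieldClauses r sch' S₁`; its `IRInputs` hypothesis is still provisional and is NOT
fixed here) can land as pure proofs:

* `curvField`, `wilsonAt`, `responseN` — the smeared renormalised curvature field of the scheme at step `k`, the
  step-`k` Wilson measure, and the complex-source RESPONSE (one-point function of `Φ_k(f₀)` in Wilson's theory with coupling
  modulated by `∑ sᵢ fᵢ`), order `n`;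
* `ResponseHolomorphy r sch s ε₁ C₀ C₁` — C⁺ of the line, NORMALISED (tests of Schwartz norm `≤ 1`; the card's un-normalised
  version is vacuous: `Theorems/MirrorModularBoostsHypercubicLimitTypedResponseVacuous.lean`);
* `UniformMomentBounds r sch` — `k`-uniform `n!` bounds on the curvature's lattice `n`-point functions on disjoint normalised
  real product tensors (the per-tuple E0′ the closure consumes);
* `OneFieldClauses r sch S₁` — the one-field clauses (verbatim the hypothesis of `Negative.OneFieldReduction.clauses_of_clauses₁`);
* `onlySpecies` (+ `latticeSchwinger_onlySpecies_of_ne/_self`) — the scheme silencing every species but one, `β` untouched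
  (adapted from `Negative/OneFieldReduction.lean`, which is not importable at present: it names the dropped
  `PencilRigidity.HypercubicLimit`).

No statement of the crux is restated here; nothing is asserted.
-/

noncomputable section

open scoped SchwartzMap
open MeasureTheory ProbabilityTheory Filter Topology
open Literature.MathematicalPhysics.AQFT Literature.MathematicalPhysics.QuantumLattice
open Literature.MathematicalPhysics.QuantumFieldTheory

namespace Summit.QuantumFields.YangMills.Cruxes.HypercubicLimit.CouplingResponse

/-! ## The line's objects -/

section Objects

variable {G : Type} [Group G] [TopologicalSpace G] [IsTopologicalGroup G] [CompactSpace G]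
  [MeasurableSpace G] [BorelSpace G]

/-- `Φ_k(f)`: the scheme's smeared renormalised curvature field at step `k` on ONE real test function,
as a function of the torus configuration (verbatim the factor integrated by `latticeSchwinger` for the
species `r.curvature`). [folklore] -/
def curvField (r : LatticeRep G) (sch : SpeciesScheme (YMSpecies G)) (k : ℕ)
    (f : 𝓢(EuclideanSpace ℝ (Fin 4), ℝ)) (U : GaugeConfig 4 (sch.side k) G) : ℝ :=
  smearedLatticeField r.curvature.F (Literature.Probability.LatticeModels.box 4 (sch.L k)) (sch.a k)
    (sch.c r.curvature k) (sch.m r.curvature k) f (torusLift (sch.side k) U)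

/-- The Wilson measure of the scheme at step `k` (torus of side `2L_k+1`, coupling `β_k`). [folklore] -/
def wilsonAt (r : LatticeRep G) (sch : SpeciesScheme (YMSpecies G)) (k : ℕ) :
    Measure (GaugeConfig 4 (sch.side k) G) :=
  wilsonMeasure r.ρ (sch.β k)

/-- The order-`n` complex-source response `s ↦ ⟨Φ_k(f₀)⟩_{k,s}`, `s : Fin n → ℂ` (sources `f₁ … f_n`). [folklore] -/
def responseN (r : LatticeRep G) (sch : SpeciesScheme (YMSpecies G)) (k : ℕ) {n : ℕ}
    (f₀ : 𝓢(EuclideanSpace ℝ (Fin 4), ℝ)) (f : Fin n → 𝓢(EuclideanSpace ℝ (Fin 4), ℝ))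
    (s : Fin n → ℂ) : ℂ :=
  (∫ U, ((curvField r sch k f₀ U : ℝ) : ℂ) *
      Complex.exp (∑ i, s i * ((curvField r sch k (f i) U : ℝ) : ℂ)) ∂(wilsonAt r sch k)) /
    ∫ U, Complex.exp (∑ i, s i * ((curvField r sch k (f i) U : ℝ) : ℂ)) ∂(wilsonAt r sch k)

/-- **C⁺ (repaired, normalised): HOLOMORPHIC COUPLING RESPONSE, uniformly in `k`.**  For every order
`n`, every observed test `f₀` and modulations `f₁ … f_n`, all REAL, NORMALISED (`|·|_s ≤ 1` in the tree's
Schwartz norm of order `s`) and with pairwise disjoint supports: the order-`n` response is holomorphic on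
the polydisc `‖s‖_∞ < ε₁/(n+1)` and bounded there by `C₀ C₁ⁿ`, for every `k`.  (The normalisation is
what the card's typed version lacked — see `stub_typedResponseVacuous`; bounds for general tests follow
by multilinearity of the Taylor coefficients.) [folklore] -/
def ResponseHolomorphy (r : LatticeRep G) (sch : SpeciesScheme (YMSpecies G)) (s : ℕ)
    (ε₁ C₀ C₁ : ℝ) : Prop :=
  ∀ (n : ℕ) (f₀ : 𝓢(EuclideanSpace ℝ (Fin 4), ℝ)) (f : Fin n → 𝓢(EuclideanSpace ℝ (Fin 4), ℝ)),
    schwartzNorm s (ofRealTest f₀) ≤ 1 → (∀ i, schwartzNorm s (ofRealTest (f i)) ≤ 1) →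
    (∀ i, Disjoint (tsupport f₀) (tsupport (f i))) →
    (∀ i j, i ≠ j → Disjoint (tsupport (f i)) (tsupport (f j))) →
      ∀ k : ℕ, DifferentiableOn ℂ (responseN r sch k f₀ f) (Metric.ball 0 (ε₁ / (n + 1))) ∧
        ∀ z ∈ Metric.ball (0 : Fin n → ℂ) (ε₁ / (n + 1)), ‖responseN r sch k f₀ f z‖ ≤ C₀ * C₁ ^ n

/-- **`k`-uniform moment bounds with `n!` growth** on the lattice `n`-point functions of the curvature
on normalised, pairwise disjointly supported real product tensors — the per-tuple form of E0′ (`γ = 1`)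
that the closure consumes (output of C⁺ by Cauchy + cumulant-to-moment bookkeeping). [folklore] -/
def UniformMomentBounds (r : LatticeRep G) (sch : SpeciesScheme (YMSpecies G)) : Prop :=
  ∃ (s : ℕ) (C₀ C₁ : ℝ), ∀ (n : ℕ) (f : Fin n → 𝓢(EuclideanSpace ℝ (Fin 4), ℝ)),
    (∀ i, schwartzNorm s (ofRealTest (f i)) ≤ 1) →
    (∀ i j, i ≠ j → Disjoint (tsupport (f i)) (tsupport (f j))) →
      ∀ k : ℕ, |latticeSchwinger r.ρ sch (fun s => s.F) k n (fun _ => r.curvature) f| ≤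
        C₀ * C₁ ^ n * n.factorial

/-- **The one-field clauses** for one witness `(r, sch, S₁)` — verbatim the hypothesis of the landed
`Negative.OneFieldReduction.clauses_of_clauses₁` (ONE scalar field, the curvature: E0, E0′, E2, E3, E4,
translation + proper-hypercubic invariance on `⁰𝒮`; convergence of the renormalised curvature `n`-point
functions along `sch`; non-triviality; non-Gaussianity; continuum gap and uniform lattice gap). [folklore] -/
def OneFieldClauses (r : LatticeRep G) (sch : SpeciesScheme (YMSpecies G))
    (S₁ : SchwingerFamily (EuclideanSpace ℝ (Fin 4))) : Prop :=
  (S₁.toLabelled.IsNormalized ∧ S₁.toLabelled.IsHermitian ∧ S₁.toLabelled.HasLinearGrowth ∧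
      S₁.toLabelled.IsReflectionPositive ∧ S₁.toLabelled.IsSymmetric ∧
      S₁.toLabelled.HasClusterProperty ∧
      (∀ (n : ℕ) (k : Fin n → Unit) (a : EuclideanSpace ℝ (Fin 4))
          (F : 𝓢((Fin n → EuclideanSpace ℝ (Fin 4)), ℂ)), IsOffDiagonal F →
        S₁.toLabelled n k (translateMulti a F) = S₁.toLabelled n k F) ∧
      (∀ (n : ℕ) (k : Fin n → Unit) (R : EuclideanSpace ℝ (Fin 4) ≃ₗᵢ[ℝ] EuclideanSpace ℝ (Fin 4)),
        LinearMap.det (R.toLinearEquiv : EuclideanSpace ℝ (Fin 4) →ₗ[ℝ] EuclideanSpace ℝ (Fin 4)) = 1 →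
        (∀ i : Fin 4, ∃ j : Fin 4, R (EuclideanSpace.single i 1) = EuclideanSpace.single j 1 ∨
          R (EuclideanSpace.single i 1) = -EuclideanSpace.single j 1) →
        ∀ F : 𝓢((Fin n → EuclideanSpace ℝ (Fin 4)), ℂ), IsOffDiagonal F →
          S₁.toLabelled n k (linActMulti R F) = S₁.toLabelled n k F)) ∧
    (∀ (n : ℕ), n ≠ 0 → ∀ (f : Fin n → 𝓢(EuclideanSpace ℝ (Fin 4), ℝ))
        (F : 𝓢((Fin n → EuclideanSpace ℝ (Fin 4)), ℂ)),
      IsTensorOf F (fun i => ofRealTest (f i)) → IsOffDiagonal F →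
        Tendsto (fun k : ℕ =>
          ((latticeSchwinger r.ρ sch (fun s => s.F) k n (fun _ => r.curvature) f : ℝ) : ℂ))
          atTop (𝓝 (S₁ n F))) ∧
    (∃ (F₁ G₁ : 𝓢((Fin 1 → EuclideanSpace ℝ (Fin 4)), ℂ))
        (H₁ : 𝓢((Fin (1 + 1) → EuclideanSpace ℝ (Fin 4)), ℂ)),
      IsTimeOrdered F₁ ∧ IsTimeOrdered G₁ ∧ IsAppendTensorOf H₁ (osAdjoint F₁) G₁ ∧
        S₁.toLabelled (1 + 1) (fun _ => ()) H₁ ≠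
          S₁.toLabelled 1 (fun _ => ()) (osAdjoint F₁) * S₁.toLabelled 1 (fun _ => ()) G₁) ∧
    (∃ (f g h : 𝓢(EuclideanSpace ℝ (Fin 4), ℂ)) (Ffgh : 𝓢((Fin 3 → EuclideanSpace ℝ (Fin 4)), ℂ))
        (Fgh Ffh Ffg : 𝓢((Fin 2 → EuclideanSpace ℝ (Fin 4)), ℂ))
        (Ff Fg Fh : 𝓢((Fin 1 → EuclideanSpace ℝ (Fin 4)), ℂ)),
      IsTensorOf Ffgh ![f, g, h] ∧ IsOffDiagonal Ffgh ∧ IsTensorOf Fgh ![g, h] ∧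
      IsTensorOf Ffh ![f, h] ∧ IsTensorOf Ffg ![f, g] ∧ IsTensorOf Ff ![f] ∧ IsTensorOf Fg ![g] ∧
      IsTensorOf Fh ![h] ∧
        S₁.toLabelled 3 (fun _ => ()) Ffgh - S₁.toLabelled 1 (fun _ => ()) Ff * S₁.toLabelled 2 (fun _ => ()) Fgh -
          S₁.toLabelled 1 (fun _ => ()) Fg * S₁.toLabelled 2 (fun _ => ()) Ffh -
          S₁.toLabelled 1 (fun _ => ()) Fh * S₁.toLabelled 2 (fun _ => ()) Ffg +
          2 * (S₁.toLabelled 1 (fun _ => ()) Ff * S₁.toLabelled 1 (fun _ => ()) Fg *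
            S₁.toLabelled 1 (fun _ => ()) Fh) ≠ 0) ∧
    (∃ Δ : ℝ, 0 < Δ ∧ S₁.toLabelled.HasMassGap Δ ∧ HasLatticeMassGap r sch Δ)

end Objects

/-! ## One field suffices: the species-silencing scheme (adapted from `Negative.OneFieldReduction`) -/

section OneField

open Summit.QuantumFields.YangMills.Theorems.HypercubicLimit.Negative

variable {G : Type} [Group G] [TopologicalSpace G] [IsTopologicalGroup G] [CompactSpace G]
  [MeasurableSpace G] [BorelSpace G]

/-- The scheme keeping the renormalisations of `s₀` and renormalising every other species to `0`;
it keeps `a`, `β`, `L` (so `HasWeakCouplingLimit` and `HasLatticeMassGap` are untouched).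
-- adapted from Theorems/HypercubicLimit/Negative/OneFieldReduction.lean [folklore] -/
def onlySpecies (sch : SpeciesScheme (YMSpecies G)) (s₀ : YMSpecies G) :
    SpeciesScheme (YMSpecies G) :=
  { sch with c := fun s k => by classical exact if s = s₀ then sch.c s k else 0 }

/-- With a species of zero multiplicative renormalisation in the string, the lattice `n`-point function
vanishes. [folklore] -/
theorem latticeSchwinger_onlySpecies_of_ne (r : LatticeRep G) (sch : SpeciesScheme (YMSpecies G))
    (s₀ : YMSpecies G) (k n : ℕ) (σ : Fin n → YMSpecies G)
    (f : Fin n → 𝓢(EuclideanSpace ℝ (Fin 4), ℝ)) {i₀ : Fin n} (hi₀ : σ i₀ ≠ s₀) :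
    latticeSchwinger r.ρ (onlySpecies sch s₀) (fun s => s.F) k n σ f = 0 := by
  unfold latticeSchwinger
  have h0 : (onlySpecies sch s₀).c (σ i₀) k = 0 := by simp [onlySpecies, hi₀]
  have : ∀ U : GaugeConfig 4 ((onlySpecies sch s₀).side k) G,
      ∏ i, smearedLatticeField ((fun s : YMSpecies G => s.F) (σ i))
        (Literature.Probability.LatticeModels.box 4 ((onlySpecies sch s₀).L k))
        ((onlySpecies sch s₀).a k) ((onlySpecies sch s₀).c (σ i) k) ((onlySpecies sch s₀).m (σ i) k)
        (f i) (torusLift ((onlySpecies sch s₀).side k) U) = 0 := fun U =>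
    Finset.prod_eq_zero (Finset.mem_univ i₀) (by rw [h0]; simp [smearedLatticeField])
  simp_rw [this, integral_zero]

/-- On the distinguished species the modified scheme has the original lattice functions. [folklore] -/
theorem latticeSchwinger_onlySpecies_self (r : LatticeRep G) (sch : SpeciesScheme (YMSpecies G))
    (s₀ : YMSpecies G) (k n : ℕ) (f : Fin n → 𝓢(EuclideanSpace ℝ (Fin 4), ℝ)) :
    latticeSchwinger r.ρ (onlySpecies sch s₀) (fun s => s.F) k n (fun _ => s₀) f =
      latticeSchwinger r.ρ sch (fun s => s.F) k n (fun _ => s₀) f := by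
  have hc : (onlySpecies sch s₀).c s₀ k = sch.c s₀ k := by simp [onlySpecies]
  unfold latticeSchwinger
  simp_rw [hc]
  rfl

end OneField

/-- **The species-silencing scheme keeps `β` and the distinguished species' lattice functions** (registered
sub-goal `onlySpecies_keeps_beta_and_self` of the line: the two facts the one-field reduction at weak coupling uses). [folklore] -/
theorem onlySpecies_keeps_beta_and_self :
    ∀ (G : Type) [Group G] [TopologicalSpace G] [IsTopologicalGroup G] [CompactSpace G] [MeasurableSpace G] [BorelSpace G] (r : LatticeRep G) (sch : SpeciesScheme (YMSpecies G)) (s₀ : YMSpecies G) (k n : ℕ) (f : Fin n → 𝓢(EuclideanSpace ℝ (Fin 4), ℝ)), (onlySpecies sch s₀).β = sch.β ∧ latticeSchwinger r.ρ (onlySpecies sch s₀) (fun s => s.F) k n (fun _ => s₀) f = latticeSchwinger r.ρ sch (fun s => s.F) k n (fun _ => s₀) f :=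
  fun _ _ _ _ _ _ _ r sch s₀ k n f => ⟨rfl, latticeSchwinger_onlySpecies_self r sch s₀ k n f⟩



/-! ## Reshape 1 (lead, cycle 2): C⁺ at ORDER ONE, `k`-uniform derivative bounds, and the glue

Appended 2026-08-16.  The transfer needs holomorphy in ONE complex source only: applied to the normalised combinations
`h = (∑ εᵢ fᵢ)/n`, one-variable Cauchy for the `n`-th derivative (landed `stub_cauchyTransferAll`) plus polarisation of the
multilinear joint cumulant recovers every truncated bound with `n!` growth.  So the line's bet is weakened from the
order-`n` polydisc statement `ResponseHolomorphy` to `ResponseHolomorphyOne` (`responseHolomorphyOne_of_responseHolomorphy`: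
the former implies the latter), and its output is `ResponseDerivBounds` (`responseDerivBounds_of_responseHolomorphyOne`,
registered sub-goal). -/

section OrderOne

variable {G : Type} [Group G] [TopologicalSpace G] [IsTopologicalGroup G] [CompactSpace G]
  [MeasurableSpace G] [BorelSpace G]

/-- The order-1 complex-source RESPONSE `t ↦ ⟨Φ_k(f₀)⟩_{k,t} = (∫ Φ_k(f₀) e^{t Φ_k(f₁)} dμ_k)/(∫ e^{t Φ_k(f₁)} dμ_k)`
(`t : ℂ`; for real `t` the expectation of `Φ_k(f₀)` in Wilson's theory with coupling modulated by `t f₁`: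
`response_ofReal`). [folklore] -/
def response (r : LatticeRep G) (sch : SpeciesScheme (YMSpecies G)) (k : ℕ)
    (f₀ f₁ : 𝓢(EuclideanSpace ℝ (Fin 4), ℝ)) (t : ℂ) : ℂ :=
  (∫ U, ((curvField r sch k f₀ U : ℝ) : ℂ) * Complex.exp (t * ((curvField r sch k f₁ U : ℝ) : ℂ))
      ∂(wilsonAt r sch k)) /
    ∫ U, Complex.exp (t * ((curvField r sch k f₁ U : ℝ) : ℂ)) ∂(wilsonAt r sch k)

/-- **C⁺ at ORDER ONE: holomorphic coupling response to ONE modulation, uniformly in `k`.**  For every observed test `f₀`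
and one modulation `f₁`, both real, normalised (`|·|_s ≤ 1` in the tree's Schwartz norm of order `s`) and disjointly
supported: the order-1 response is holomorphic on the disc `|t| < ε₁` and bounded there by `C₀`, for every `k`. [folklore] -/
def ResponseHolomorphyOne (r : LatticeRep G) (sch : SpeciesScheme (YMSpecies G)) (s : ℕ) (ε₁ C₀ : ℝ) : Prop :=
  ∀ (f₀ f₁ : 𝓢(EuclideanSpace ℝ (Fin 4), ℝ)),
    schwartzNorm s (ofRealTest f₀) ≤ 1 → schwartzNorm s (ofRealTest f₁) ≤ 1 →
    Disjoint (tsupport f₀) (tsupport f₁) →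
      ∀ k : ℕ, DifferentiableOn ℂ (response r sch k f₀ f₁) (Metric.ball 0 ε₁) ∧
        ∀ t ∈ Metric.ball (0 : ℂ) ε₁, ‖response r sch k f₀ f₁ t‖ ≤ C₀

/-- **`k`-uniform bounds on all real derivatives at `0` of the order-1 responses** (the joint cumulants
`κ_{n+1}(Φ_k(f₀); Φ_k(f₁)^{×n})`): `|dⁿ/dtⁿ|₀ ∫ Φ_k(f₀) d(μ_k.tilted (t Φ_k(f₁)))| ≤ C₀ C₁ⁿ n!` for all normalised disjoint
real pairs, all `k`, all `n`. [folklore] -/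
def ResponseDerivBounds (r : LatticeRep G) (sch : SpeciesScheme (YMSpecies G)) : Prop :=
  ∃ (s : ℕ) (C₀ C₁ : ℝ), ∀ (f₀ f₁ : 𝓢(EuclideanSpace ℝ (Fin 4), ℝ)),
    schwartzNorm s (ofRealTest f₀) ≤ 1 → schwartzNorm s (ofRealTest f₁) ≤ 1 →
    Disjoint (tsupport f₀) (tsupport f₁) →
      ∀ k n : ℕ, |iteratedDeriv n (fun t : ℝ => ∫ U, curvField r sch k f₀ U
          ∂((wilsonAt r sch k).tilted (fun U => t * curvField r sch k f₁ U))) 0| ≤ C₀ * C₁ ^ n * n.factorial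

/-- **The order-`n` polydisc statement implies the order-one statement** (its `n = 1` case, read on constant sources
`ℂ → (Fin 1 → ℂ)`): the reshape WEAKENS the line's bet. [folklore] -/
theorem responseHolomorphyOne_of_responseHolomorphy (r : LatticeRep G) (sch : SpeciesScheme (YMSpecies G))
    {s : ℕ} {ε₁ C₀ C₁ : ℝ} (h : ResponseHolomorphy r sch s ε₁ C₀ C₁) :
    ResponseHolomorphyOne r sch s (ε₁ / ((1 : ℕ) + 1)) (C₀ * C₁ ^ 1) := by
  intro f₀ f₁ h₀ h₁ hd k
  have hn : ∀ i : Fin 1, schwartzNorm s (ofRealTest (![f₁] i)) ≤ 1 := fun i => by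
    fin_cases i; simpa using h₁
  have hd1 : ∀ i : Fin 1, Disjoint (tsupport f₀) (tsupport (![f₁] i)) := fun i => by
    fin_cases i; simpa using hd
  have hd2 : ∀ i j : Fin 1, i ≠ j → Disjoint (tsupport (![f₁] i)) (tsupport (![f₁] j)) :=
    fun i j hij => absurd (Subsingleton.elim i j) hij
  obtain ⟨hD, hB⟩ := h 1 f₀ ![f₁] h₀ hn hd1 hd2 k
  have hcomp : response r sch k f₀ f₁ = responseN r sch k f₀ ![f₁] ∘ fun t : ℂ => fun _ : Fin 1 => t := by
    funext t
    simp [response, responseN]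
  constructor
  · rw [hcomp]
    refine hD.comp ?_ fun t ht => const_mem_ball_fin_one (by simpa using ht)
    exact (differentiable_pi.2 fun _ => differentiable_id).differentiableOn
  · intro t ht
    have := hB (fun _ => t) (const_mem_ball_fin_one (by simpa using ht))
    rw [hcomp]
    exact this

/-- **Glue: C⁺ at order one ⇒ `k`-uniform derivative bounds** (registered sub-goal of the line), by the landed
`stub_cauchyTransferAll` with `C₁ = 2/ε₁`. [folklore] -/
theorem responseDerivBounds_of_responseHolomorphyOne :
    ∀ (G : Type) [Group G] [TopologicalSpace G] [IsTopologicalGroup G] [CompactSpace G] [MeasurableSpace G] [BorelSpace G] (r : LatticeRep G) (sch : SpeciesScheme (YMSpecies G)) (s : ℕ) (ε₁ C₀ : ℝ), 0 < ε₁ → ResponseHolomorphyOne r sch s ε₁ C₀ → ResponseDerivBounds r sch := by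
  intro G _ _ _ _ _ _ r sch s ε₁ C₀ hε₁ h
  refine ⟨s, C₀, 2 / ε₁, fun f₀ f₁ h₀ h₁ hd k n => ?_⟩
  obtain ⟨hD, hB⟩ := h f₀ f₁ h₀ h₁ hd k
  have hc := stub_cauchyTransferAll G r sch k f₀ f₁ ε₁ C₀ hε₁ hD hB n
  refine hc.trans (le_of_eq ?_)
  rw [div_pow, div_pow]
  field_simp

end OrderOne

end Summit.QuantumFields.YangMills.Cruxes.HypercubicLimit.CouplingResponse

end
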